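import Literature.Probability.LatticeModels.SixVertexSpectralRepresentation

/-!
# Six-vertex model on the torus: expectations only see ice configurations, the flux form of the
# ice rule, and path independence of height differences over rectangles (DKLM 2026, §2.2 / §4.5.1)

H. Duminil-Copin, K. K. Kozlowski, P. Lammers, I. Manolescu, *Gaussian free field convergence of
the six-vertex model with `-1 ≤ Δ ≤ -1/2`*, arXiv:2603.06268 (2026) [DKLM2026SixVertexGFF]
(`paper:arxiv-2603.06268`, chunks p0010, p0018):

> **Definition 2.3** (Height function). […] the face on the left of each arrow is one unit higher
> than the face on its right. […] (§4.5.1) Balanced six-vertex configurations `ω` on `CYL_L` are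
> in bijection with gradient height functions `h : F(CYL_L) → ℤ`. To see that this is true, we
> remark that any oriented loop on the dual graph of `CYL_L` intersects the same number of left-
> and right-pointing arrows (relative to the orientation of the loop), thanks to the ice rule and
> the balanced condition.

For the objects of `SixVertexGFF.lean` / `SixVertexSpectralRepresentation.lean` on a torus
`G₁ × G₂`:

* `torusCondExp_congr_of_ice` — **`𝔼_{𝕋}[· | balanced]` only depends on the observable on ice
  configurations** (the weight `W(ω)` vanishes as soon as the ice rule fails at one vertex);
* `arrowSign` (`±1` of an arrow bit) and the **flux form of the ice rule**
  `iceRuleAt_flux`: `E(x-1,y) + N(x,y-1) = E(x,y) + N(x,y)` for the `±1` values of the east and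
  north edges at an ice vertex `(x,y)` (two in, two out);
* **path independence over a rectangle** (`rect_path_independence`): for a configuration
  satisfying the ice rule at the interior corners, the height gain "east `n` steps, then north
  `q` steps" equals "north `q` steps, then east `n` steps" (Def. 2.3: east steps gain `-N`, north
  steps gain `+E`), by the one-row identity `row_path_independence` and induction — the contractible
  case of the loop statement quoted above, which makes height differences of strip observables
  well defined `𝔼_{𝕋}[· | balanced]`-almost surely.

## References

* H. Duminil-Copin, K. K. Kozlowski, P. Lammers, I. Manolescu, arXiv:2603.06268 (2026), Def. 2.3
  and §4.5.1. [DKLM2026SixVertexGFF]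
-/

noncomputable section

open Finset

namespace Literature.Probability.LatticeModels.SixVertex

/-! ### Expectations only see ice configurations -/

section Ice

variable {G₁ G₂ : Type*} [AddGroup G₁] [AddGroup G₂] [One G₁] [One G₂] [Fintype G₁] [Fintype G₂]
  [DecidableEq G₁] [DecidableEq G₂]

/-- **`𝔼_{𝕋}[F | balanced] = 𝔼_{𝕋}[G | balanced]` whenever `F = G` on ice configurations**
(`W(ω) = 0` off the ice rule). [cite: DKLM2026SixVertexGFF, Def. 2.1] -/
theorem torusCondExp_congr_of_ice (a b c : ℝ) {F G : Config (G₁ × G₂) → ℝ}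
    (h : ∀ ω, (∀ v, IceRuleAt ω v) → F ω = G ω) : torusCondExp a b c F = torusCondExp a b c G := by
  unfold torusCondExp
  congr 1
  refine Finset.sum_congr rfl fun ω _ => ?_
  split_ifs with hb
  · by_cases hice : ∀ v, IceRuleAt ω v
    · rw [h ω hice]
    · push Not at hice
      obtain ⟨v, hv⟩ := hice
      unfold IceRuleAt at hv
      rw [torusWeight_eq_zero_of_ne a b c hv, mul_zero, mul_zero]
  · rfl

end Ice

/-! ### The `±1` values of arrows and the flux form of the ice rule -/

/-- The `±1` value of an arrow bit (`+1` for east / north). [cite: DKLM2026SixVertexGFF, Def. 2.3] -/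
def arrowSign (b : Bool) : ℝ := if b = true then 1 else -1

/-- Reversing an arrow changes the sign. [folklore] -/
@[simp] theorem arrowSign_not (b : Bool) : arrowSign (!b) = -arrowSign b := by
  cases b <;> simp [arrowSign]

/-- `arrowSign true = 1`. [folklore] -/
@[simp] theorem arrowSign_true : arrowSign true = 1 := rfl

/-- `arrowSign false = -1`. [folklore] -/
@[simp] theorem arrowSign_false : arrowSign false = -1 := rfl

section Flux

variable {G₁ G₂ : Type*} [AddGroup G₁] [AddGroup G₂] [One G₁] [One G₂]

/-- **The flux form of the ice rule**: at an ice vertex `(x, y)` (two in, two out),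
`E(x-1,y) + N(x,y-1) = E(x,y) + N(x,y)` for the `±1` values `E`, `N` of east / north edges.
[cite: DKLM2026SixVertexGFF, Def. 2.1 and Def. 2.3] -/
theorem iceRuleAt_flux (ω : Config (G₁ × G₂)) (x : G₁) (y : G₂) (hv : IceRuleAt ω (x, y)) :
    arrowSign (ω (x - 1, y)).1 + arrowSign (ω (x, y - 1)).2 =
      arrowSign (ω (x, y)).1 + arrowSign (ω (x, y)).2 := by
  have key : ∀ E W N S : Bool,
      (if E = true then 0 else 1) + (if W = true then 1 else 0) + (if N = true then 0 else 1) +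
          (if S = true then 1 else 0) = 2 →
        arrowSign W + arrowSign S = arrowSign E + arrowSign N := by
    intro E W N S
    cases E <;> cases W <;> cases N <;> cases S <;> norm_num [arrowSign]
  exact key _ _ _ _ hv

/-- **One-row path independence**: across the vertex columns `x₀+1, …, x₀+n` between the rows
`y` and `y - 1`, "east along the lower row then north at the end" gains the same height as
"north at the start then east along the upper row", provided the ice rule holds at the vertices
`(x₀ + (s+1), y)`, `s < n` (east steps gain `-N`, north steps gain `+E`, Def. 2.3).
[cite: DKLM2026SixVertexGFF, Def. 2.3 and §4.5.1] -/
theorem row_path_independence (ω : Config (G₁ × G₂)) (x₀ : G₁) (y : G₂) (n : ℕ)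
    (hice : ∀ s : ℕ, s < n → IceRuleAt ω (x₀ + (s + 1) • (1 : G₁), y)) :
    (∑ s ∈ Finset.range n, -arrowSign (ω (x₀ + (s + 1) • (1 : G₁), y - 1)).2) +
        arrowSign (ω (x₀ + n • (1 : G₁), y)).1 =
      arrowSign (ω (x₀, y)).1 + ∑ s ∈ Finset.range n, -arrowSign (ω (x₀ + (s + 1) • (1 : G₁), y)).2 := by
  induction n with
  | zero => simp
  | succ n ih =>
    have hflux := iceRuleAt_flux ω (x₀ + (n + 1) • (1 : G₁)) y (hice n (Nat.lt_succ_self n))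
    rw [show x₀ + (n + 1) • (1 : G₁) - 1 = x₀ + n • (1 : G₁) by rw [succ_nsmul, ← add_assoc, add_sub_cancel_right]]
      at hflux
    rw [Finset.sum_range_succ, Finset.sum_range_succ]
    have ih' := ih (fun s hs => hice s (Nat.lt_succ_of_lt hs))
    linarith

/-- **Path independence over a rectangle**: from the face `(x₀, y₀)` to the face
`(x₀ + n, y₀ + q)` (bottom-left corners), "east `n` then north `q`" and "north `q` then east `n`"
gain the same height whenever the ice rule holds at the vertices `(x₀ + (s+1), y₀ + (m+1))`,
`s < n`, `m < q`. [cite: DKLM2026SixVertexGFF, Def. 2.3 and §4.5.1] -/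
theorem rect_path_independence (ω : Config (G₁ × G₂)) (x₀ : G₁) (y₀ : G₂) (n q : ℕ)
    (hice : ∀ s m : ℕ, s < n → m < q →
      IceRuleAt ω (x₀ + (s + 1) • (1 : G₁), y₀ + (m + 1) • (1 : G₂))) :
    (∑ s ∈ Finset.range n, -arrowSign (ω (x₀ + (s + 1) • (1 : G₁), y₀)).2) +
        ∑ m ∈ Finset.range q, arrowSign (ω (x₀ + n • (1 : G₁), y₀ + (m + 1) • (1 : G₂))).1 =
      (∑ m ∈ Finset.range q, arrowSign (ω (x₀, y₀ + (m + 1) • (1 : G₂))).1) +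
        ∑ s ∈ Finset.range n, -arrowSign (ω (x₀ + (s + 1) • (1 : G₁), y₀ + q • (1 : G₂))).2 := by
  induction q with
  | zero => simp
  | succ q ih =>
    have hrow := row_path_independence ω x₀ (y₀ + (q + 1) • (1 : G₂)) n
      (fun s hs => hice s q hs (Nat.lt_succ_self q))
    rw [show y₀ + (q + 1) • (1 : G₂) - 1 = y₀ + q • (1 : G₂) by
      rw [succ_nsmul, ← add_assoc, add_sub_cancel_right]] at hrow
    have ih' := ih (fun s m hs hm => hice s m hs (Nat.lt_succ_of_lt hm))
    rw [Finset.sum_range_succ, Finset.sum_range_succ]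
    linarith

end Flux

end Literature.Probability.LatticeModels.SixVertex

end
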